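import Literature.NumberTheory.EllipticCurves.CongruentNewformMultiplierProofs
import Literature.NumberTheory.ModularForms.EisensteinE2LevelForms
import Literature.NumberTheory.ModularForms.LevelSixEisensteinQExpansions
import HarnessLib

/-!
# The weight-two multiplier `(E₂(τ) − M E₂(Mτ))/(1 − M)` and congruent newforms of weight
# `k₀ + 2` at `p = 3` (and `p = 2`) (proofs only)

Topic `Literature/NumberTheory/EllipticCurves`; namespace
`Literature.NumberTheory.EllipticCurves.ModularForms`.  THEOREMS ONLY (no definition, no named
fact; D-0026).  Second half of `CongruentNewformMultiplierProofs.lean`: that file runs the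
Deligne–Serre congruence `f ↦` newform of weight `k₀ + w` congruent to `f` through an ARBITRARY
`Γ₀(N)`-invariant multiplier `E ∈ M_w(Γ₁(N))` with `q`-expansion `≡ 1 (mod 𝔪_{ℚ̄_p})`
(`exists_isNewform0_dvd_level_congr_of_multiplier`).  Serre's multiplier is the level-one
Eisenstein series `E_{p−1} ≡ 1 (mod p)`, which does not exist for `p = 3` in weight `2`.  Here the
missing weight-two multiplier is supplied: for a divisor `M ∣ N`, the genuine weight-two modular
form `Φ_M = E₂(τ) − M E₂(Mτ) ∈ M₂(Γ₀(M))` of the tree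
(`Literature.NumberTheory.ModularForms.phiE2ModularForm`, Diamond–Shurman §1.2; `q`-expansion
`(1 − M) − 24 Σ_{n ≥ 1} (σ₁(n) − M·𝟙_{M ∣ n} σ₁(n/M)) qⁿ`, `Literature.NumberTheory.ModularForms.hasSum_phiE2`),
normalised to `Φ_M/(1 − M)`, has constant term `1` and all other coefficients in
`24/(1 − M) · ℤ ⊆ p ℤ_{(p)}` as soon as `p ∣ 24` and `p ∤ (M − 1)`:

* `phiE2Coeff_zero`, `exists_phiE2Coeff_eq_intCast`, `qExpansion_coeff_phiE2ModularForm` — the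
  `q`-coefficients of `Φ_M` (`a₀ = 1 − M`, `a_n ∈ 24ℤ` for `n ≥ 1`; the bundled `q`-expansion);
* `exists_weightTwo_multiplier_of_dvd` — for `p ∣ 24`, `M ∣ N`, `p ∤ (1 − M)`: a `Γ₀(N)`-invariant
  `E ∈ M₂(Γ₁(N))` with `a₀(E) = 1`, `|ι⁻¹ a_j(E)|_p < 1` (`j ≥ 1`);
* `exists_isNewform0_dvd_level_congr_weight_add_two` — for `p ∈ {2, 3}`, a newform
  `f ∈ S_{k₀}(Γ₀(N))`, `k₀ ≥ 2`, and a divisor `M ∣ N` with `p ∤ (M − 1)` (at `p = 3`: some divisor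
  of `N` is `≢ 1 (mod 3)`, e.g. a prime `q ∣ N` with `q ≢ 1 (mod 3)`): a newform
  `g ∈ S_{k₀+2}(Γ₀(M′))`, `M′ ∣ N`, with `a_q(g) ≡ a_q(f) (mod 𝔪_{ℚ̄_p})` for every prime `q ∤ N` —
  the weight-`4` companion of a weight-`2` newform at `p = 3` that the level-one argument cannot
  reach (the case `w = p − 1` of the «companion in weight `p + 1`» used by the BSD crux line
  `edge_seed_rigidity` of `Summits/BirchSwinnertonDyer/…/Cruxes/KobayashiLowerHalfLargeImage`).

What is NOT covered (said, not hidden): at `p = 3`, levels `N` all of whose divisors are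
`≡ 1 (mod 3)` (equivalently: every prime factor of `N` is `≡ 1 (mod 3)`) carry no weight-two
Eisenstein series `≡ 1 (mod 3)` of this shape (`Φ_M ≡ 1 − M ≡ 0`); there the weight-`4` companion
needs the Hasse invariant / Katz–Serre weight raising (`θ`-cycles), which is not in the tree.

## References

* P. Deligne, J.-P. Serre, *Formes modulaires de poids 1*, Ann. Sci. ÉNS (4) 7 (1974), 507–530,
  6.9–6.11. [DeligneSerreASENS1974]
* F. Diamond, J. Shurman, *A First Course in Modular Forms*, GTM 228 (2005), §1.2 (the form
  `E₂(τ) − N E₂(Nτ)`), Thm. 5.8.2–5.8.3 (Atkin–Lehner–Li). [DiamondShurman2005]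
* J.-P. Serre, *Formes modulaires et fonctions zêta `p`-adiques*, in Modular Functions of One
  Variable III, LNM 350 (1973), §1 (congruences `E_{p−1} ≡ 1`; context only).
-/

noncomputable section

open scoped MatrixGroups ModularForm Manifold
open CongruenceSubgroup UpperHalfPlane

namespace Literature.NumberTheory.EllipticCurves.ModularForms

/-- An integer divisible by `p` has norm `< 1` in `ℚ̄_p`. [folklore] -/
private theorem wt2_norm_intCast_lt_one_of_dvd {p : ℕ} [Fact p.Prime] {z : ℤ} (hz : (p : ℤ) ∣ z) :
    ‖(z : PadicAlgCl p)‖ < 1 := by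
  rw [← map_intCast (algebraMap ℚ_[p] (PadicAlgCl p)) z]
  change ‖((z : ℚ_[p]) : PadicAlgCl p)‖ < 1
  rw [PadicAlgCl.norm_extends]
  exact Padic.norm_intCast_lt_one_iff.2 hz

/-! ### The weight-two multiplier `Φ_M/(1 − M)`, `Φ_M = E₂(τ) − M E₂(Mτ)` -/

section WeightTwo

open Literature.NumberTheory.ModularForms

variable {p : ℕ} [Fact p.Prime]

/-- The constant term of `Φ_δ = E₂ − δE₂(δ·)` is `1 − δ`. [cite: DiamondShurman2005, §1.2] -/
theorem phiE2Coeff_zero (δ : ℕ) : phiE2Coeff δ 0 = 1 - δ := by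
  unfold phiE2Coeff e2NatMulCoeff e2Coeff
  simp

/-- The higher `q`-coefficients of `Φ_δ = E₂ − δE₂(δ·)` are integers divisible by `24`:
`a_m(Φ_δ) = −24 (σ₁(m) − δ·𝟙_{δ ∣ m} σ₁(m/δ))` for `m ≥ 1`. [cite: DiamondShurman2005, §1.2] -/
theorem exists_phiE2Coeff_eq_intCast (δ : ℕ) {m : ℕ} (hm : m ≠ 0) :
    ∃ z : ℤ, phiE2Coeff δ m = ((24 * z : ℤ) : ℂ) := by
  unfold phiE2Coeff e2NatMulCoeff e2Coeff
  rw [if_neg hm]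
  by_cases hd : δ ∣ m
  · rw [if_pos hd]
    obtain ⟨c, rfl⟩ := hd
    have hδ : δ ≠ 0 := by rintro rfl; exact hm (zero_mul c)
    have hc : c ≠ 0 := by rintro rfl; exact hm (mul_zero δ)
    rw [Nat.mul_div_cancel_left c (Nat.pos_of_ne_zero hδ), if_neg hc]
    refine ⟨-(ArithmeticFunction.sigma 1 (δ * c) : ℤ) + δ * (ArithmeticFunction.sigma 1 c : ℤ), ?_⟩
    push_cast
    ring
  · rw [if_neg hd]
    exact ⟨-(ArithmeticFunction.sigma 1 m : ℤ), by push_cast; ring⟩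

/-- **The `q`-expansion of `Φ_δ = E₂(τ) − δE₂(δτ) ∈ M₂(Γ₀(δ))`, coefficientwise**
(`(1 − δ) − 24 Σ (σ₁(n) − δ 𝟙_{δ∣n} σ₁(n/δ)) qⁿ`; the tree's `hasSum_phiE2` read as the `q`-expansion
of the bundled form `phiE2ModularForm δ`). [cite: DiamondShurman2005, §1.2] -/
theorem qExpansion_coeff_phiE2ModularForm (δ : ℕ) [NeZero δ] (n : ℕ) :
    (qExpansion 1 ⇑(phiE2ModularForm δ)).coeff n = phiE2Coeff δ n :=
  qExpansion_coeff_eq_of_hasSum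
    (SlashInvariantFormClass.periodic_comp_ofComplex (phiE2ModularForm δ)
      (one_mem_strictPeriods_coe_gamma0 δ))
    (ModularFormClass.holo (phiE2ModularForm δ)) (ModularFormClass.bdd_at_infty (phiE2ModularForm δ))
    (fun τ ↦ hasSum_phiE2 δ (NeZero.pos δ) τ) n

/-- **The weight-two multiplier `Φ_M/(1 − M)` at a prime `p ∣ 24` (i.e. `p ∈ {2, 3}`).**  For
`M ∣ N` with `p ∤ (1 − M)` there is a modular form `E ∈ M₂(Γ₁(N))` — namely
`(1 − M)⁻¹ · (E₂(τ) − M E₂(Mτ))` restricted from `Γ₀(M) ≥ Γ₁(N)` — invariant under all of `Γ₀(N)`,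
with constant term `1` and every other `q`-coefficient of `p`-adic absolute value `< 1` (they are
the rational numbers `−24 (σ₁(n) − M 𝟙_{M∣n} σ₁(n/M))/(1 − M) ∈ p ℤ_{(p)}`).  At `p = 3` this is the
substitute for the non-existent `E_2` in Serre's argument `f ↦ f · E_{p−1}`.
[cite: DiamondShurman2005, §1.2] -/
theorem exists_weightTwo_multiplier_of_dvd (ι : PadicAlgCl p ≃+* ℂ) (hp24 : p ∣ 24) {N M : ℕ}
    [NeZero N] (hMN : M ∣ N) (hM : ¬ (p : ℤ) ∣ 1 - (M : ℤ)) :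
    ∃ E : ModularForm (Gamma1 N) 2,
      (∀ γ : SL(2, ℤ), γ ∈ Gamma0 N → (⇑E : ℍ → ℂ) ∣[(2 : ℤ)] γ = ⇑E) ∧
      (qExpansion 1 ⇑E).coeff 0 = 1 ∧
      ∀ j : ℕ, j ≠ 0 → ‖ι.symm ((qExpansion 1 ⇑E).coeff j)‖ < 1 := by
  classical
  haveI : NeZero M := ⟨fun h ↦ NeZero.ne N (zero_dvd_iff.mp (h ▸ hMN))⟩
  have hMpos : 0 < M := NeZero.pos M
  -- `M ≠ 1`, so `1 − M` is invertible in `ℂ`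
  have hM1 : (1 : ℂ) - (M : ℂ) ≠ 0 := by
    intro h
    have hM' : (M : ℂ) = 1 := by linear_combination -h
    have hM1' : M = 1 := by exact_mod_cast hM'
    apply hM
    rw [hM1']
    simp
  set c : ℂ := ((1 : ℂ) - (M : ℂ))⁻¹ with hc
  -- the form `c · Φ_M` on `Γ₁(N) ≤ Γ₀(N) ≤ Γ₀(M)`
  have hle : Gamma1 N ≤ Gamma0 M := (Gamma1_in_Gamma0 N).trans (gamma0_le_gamma0_of_dvd hMN)
  let E : ModularForm (Gamma1 N) 2 := c • ofLevelLe hle (phiE2ModularForm M)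
  have hcoe : (⇑E : ℍ → ℂ) = c • phiE2 M hMpos := by
    change ⇑(c • ofLevelLe hle (phiE2ModularForm M)) = _
    rw [ModularForm.IsGLPos.coe_smul]
    rfl
  -- its `q`-expansion: `c · a_n(Φ_M)`
  have hq : ∀ n, (qExpansion 1 ⇑E).coeff n = c * phiE2Coeff M n := by
    intro n
    refine qExpansion_coeff_eq_of_hasSum (c := fun m ↦ c * phiE2Coeff M m)
      (SlashInvariantFormClass.periodic_comp_ofComplex E (HeckeTGamma1.one_mem_strictPeriods_Gamma1 N))
      (ModularFormClass.holo E) (ModularFormClass.bdd_at_infty E) (fun τ ↦ ?_) n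
    rw [hcoe, Pi.smul_apply, smul_eq_mul]
    refine ((hasSum_phiE2 M hMpos τ).mul_left c).congr_fun fun m ↦ ?_
    simp only [smul_eq_mul]
    ring
  refine ⟨E, fun γ hγ ↦ ?_, ?_, fun j hj ↦ ?_⟩
  · -- `Γ₀(N)`-invariance: `Φ_M ∣₂ γ = Φ_M` for `γ ∈ Γ₀(N) ≤ Γ₀(M)`
    rw [hcoe, ModularForm.SL_smul_slash, phiE2_slash M hMpos (gamma0_le_gamma0_of_dvd hMN hγ)]
  · -- constant term `c (1 − M) = 1`
    rw [hq, phiE2Coeff_zero, hc]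
    exact inv_mul_cancel₀ hM1
  · -- `a_j = c · 24 z`, `|c|_p = 1`, `|24 z|_p < 1`
    obtain ⟨z, hz⟩ := exists_phiE2Coeff_eq_intCast M hj
    rw [hq, hz, map_mul, map_intCast, hc, map_inv₀, map_sub, map_one, map_natCast]
    have h1 : ‖((1 : PadicAlgCl p) - (M : PadicAlgCl p))⁻¹‖ = 1 := by
      rw [norm_inv, show (1 : PadicAlgCl p) - (M : PadicAlgCl p) = ((1 - (M : ℤ) : ℤ) : PadicAlgCl p)
        by push_cast; ring, DeligneSerreLift.norm_intCast_eq_one_of_not_dvd hM, inv_one]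
    have h24 : ‖((24 * z : ℤ) : PadicAlgCl p)‖ < 1 :=
      wt2_norm_intCast_lt_one_of_dvd (Dvd.dvd.mul_right (by exact_mod_cast hp24) z)
    rw [norm_mul, h1, one_mul]
    exact h24

/-- **Congruent newforms of weight `k₀ + 2` at `p ∈ {2, 3}` (Deligne–Serre with the weight-two
multiplier).**  Let `p` be a prime dividing `24`, `ι : ℚ̄_p ≃ ℂ`, `f ∈ S_{k₀}(Γ₀(N))` a newform of
weight `k₀ ≥ 2`, and suppose SOME divisor `M ∣ N` satisfies `p ∤ (1 − M)` (at `p = 3`: `N` has a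
divisor `≢ 1 (mod 3)`; at `p = 2`: `N` is even).  Then there are `M′ ∣ N` and a newform
`g ∈ S_{k₀+2}(Γ₀(M′))` with `a_q(g) ≡ a_q(f)` modulo the maximal ideal of `𝒪_{ℚ̄_p}` (read through
`ι⁻¹`) for every prime `q ∤ N`: `exists_isNewform0_dvd_level_congr_of_multiplier` with the multiplier
`Φ_M/(1 − M)` of `exists_weightTwo_multiplier_of_dvd` (`(p − 1) ∣ 2` for `p ∈ {2, 3}`).  This is
the weight-`(k₀ + p − 1)` companion at `p = 3`, which the level-one Eisenstein series cannot supply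
(`E_2` is not modular). [cite: DeligneSerreASENS1974, 6.9–6.11] [cite: DiamondShurman2005, §1.2 and Thm. 5.8.2–5.8.3] -/
theorem exists_isNewform0_dvd_level_congr_weight_add_two (ι : PadicAlgCl p ≃+* ℂ) (hp24 : p ∣ 24)
    {N : ℕ} [NeZero N] {k₀ : ℤ} (hk₀ : 2 ≤ k₀) {f : CuspForm (Gamma0 N) k₀} (hf : IsNewform0 f)
    {M : ℕ} (hMN : M ∣ N) (hM : ¬ (p : ℤ) ∣ 1 - (M : ℤ)) :
    ∃ (M' : ℕ) (_ : NeZero M') (_ : M' ∣ N) (g : CuspForm (Gamma0 M') (k₀ + 2)),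
      IsNewform0 g ∧
      ∀ q : ℕ, q.Prime → ¬ q ∣ N →
        ‖ι.symm ((qExpansion 1 ⇑g).coeff q) - ι.symm ((qExpansion 1 ⇑f).coeff q)‖ < 1 := by
  have hp : p.Prime := Fact.out
  obtain ⟨E, hEΓ, hE0, hEnorm⟩ := exists_weightTwo_multiplier_of_dvd ι hp24 hMN hM
  -- `p ∣ 24 ⇒ p ∈ {2, 3} ⇒ (p − 1) ∣ 2`
  have hpw : (p - 1) ∣ 2 := by
    have h23 : p = 2 ∨ p = 3 := by
      have h24 : (24 : ℕ) = 2 ^ 3 * 3 := by norm_num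
      rw [h24] at hp24
      rcases hp.dvd_mul.mp hp24 with h | h
      · exact Or.inl ((Nat.prime_dvd_prime_iff_eq hp Nat.prime_two).mp (hp.dvd_of_dvd_pow h))
      · exact Or.inr ((Nat.prime_dvd_prime_iff_eq hp Nat.prime_three).mp h)
    rcases h23 with rfl | rfl <;> norm_num
  exact exists_isNewform0_dvd_level_congr_of_multiplier ι hk₀ hf (w := 2) hpw E hEΓ hE0 hEnorm

end WeightTwo

end Literature.NumberTheory.EllipticCurves.ModularForms

end
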